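import Summits.KontsevichZagierPeriods.KontsevichZagierPeriods.Theorems.HermiteRigidityIslandComplementCubeReflection

/-!
# `ReductionRigidity` (stmt-KontsevichZagierPeriods-3407), line `Sketch`, stub `stub_islandComplement`:
# the five-term certificate, II — the logarithmic term on `□³` (`stub_fiveTermLogPrimitives`)

Route `KontsevichZagierPeriods/HermiteRigidity`, crux `ReductionRigidity` (stmt-3407); growth deliverable
G5 of `Cruxes/ReductionRigidity/STUB-PLAN-stub_islandComplement.md` (the five-term relation as a chain
of moves), part 2. In Abel's form of the five-term relation the elementary term is the product of two
logarithms, `log((1−x)/(1−xy)) · log((1−y)/(1−xy))`; along the deformation `x ↦ sx` it is the product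
representation `[□², ℓ₁(p,s)·ℓ₂(q,s)]` of the two dlog integrands

  `ℓ₁(p,s) = −sx(1−y)/E₁`,  `E₁ = 1 − sx(y + (1−y)p)`   (`∫₀¹ ℓ₁ dp = log((1−sx)/(1−sxy))`),
  `ℓ₂(q,s) = −y(1−sx)/E₂`,  `E₂ = 1 − y(sx + (1−sx)q)`   (`∫₀¹ ℓ₂ dq = log((1−y)/(1−sxy))`).

This file supplies, as regular rational functions on `□³` (coordinates `p = p₀`, `q = p₁`, `s = p₂`):
`W = ℓ₁ℓ₂`, `G_W = (∂ₛΛ₁)·ℓ₂` and `H_W = ℓ₁·(∂ₛΛ₂)` where `Λ₁ = log E₁`, `Λ₂ = log E₂` (so that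
`∂ₛΛ₁ = −x(y + (1−y)p)/E₁`, `∂ₛΛ₂ = −xy(1−q)/E₂` are RATIONAL), with their values and the derivative
values realising the exactness `∂ₛW = ∂ₚG_W + ∂_qH_W`:

  `∂ₚG_W = xy(1−y)(1−sx)/(E₁²E₂)`,  `∂_qH_W = −s x² y (1−y)²/(E₁E₂²)`,  `∂ₛW =` their sum.

`E₁ ≥ 1 − x` and `E₂ ≥ 1 − y` on the closed cube, so everything is regular there; derivatives are
computed symbolically (`rfun_pd_fn_eq`). References: M. Kontsevich, D. Zagier, *Periods* (2001), §1.2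
[cite: KontsevichZagier2001, §1.2]; D. Zagier, *The dilogarithm function* (2007), Ch. I §2
[cite: Zagier2007Dilogarithm, Ch. I §2]. No definitions are introduced.
-/

noncomputable section

open MeasureTheory Set MvPolynomial

namespace Summit.KontsevichZagierPeriods.HermiteRigidity.ReductionRigidity

open Literature.NumberTheory.Transcendental
open Literature.NumberTheory.Transcendental.KZ

/-! ## Bounds on the closed cube `□³` -/

/-- `E₁ = 1 − sx(y + (1−y)p) ≥ 1 − x > 0` and `E₂ = 1 − y(sx + (1−sx)q) ≥ 1 − y > 0` on `□³`
(`0 < x, y < 1`). [folklore] -/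
theorem fiveTerm_log_den_pos {x y : ℚ} (hx : 0 < x) (hx1 : x < 1) (hy : 0 < y) (hy1 : y < 1)
    {p : Fin 3 → ℝ} (hp : p ∈ cube 3) :
    0 < 1 - (x:ℝ) * p 2 * ((y:ℝ) + (1 - y) * p 0) ∧
      0 < 1 - (y:ℝ) * ((x:ℝ) * p 2 + (1 - (x:ℝ) * p 2) * p 1) := by
  have hx' : (0:ℝ) < x := by exact_mod_cast hx
  have hx1' : (x:ℝ) < 1 := by exact_mod_cast hx1
  have hy' : (0:ℝ) < y := by exact_mod_cast hy
  have hy1' : (y:ℝ) < 1 := by exact_mod_cast hy1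
  have h0 := hp 0; have h1 := hp 1; have h2 := hp 2
  have hm0 : 0 ≤ (y:ℝ) + (1 - y) * p 0 := by nlinarith
  have hm1 : (y:ℝ) + (1 - y) * p 0 ≤ 1 := by nlinarith
  have hxp0 : 0 ≤ (x:ℝ) * p 2 := by nlinarith
  have hxp1 : (x:ℝ) * p 2 ≤ x := by nlinarith
  have hE1 : (x:ℝ) * p 2 * ((y:ℝ) + (1 - y) * p 0) ≤ x * 1 := mul_le_mul hxp1 hm1 hm0 hx'.le
  have hn0 : 0 ≤ (x:ℝ) * p 2 + (1 - (x:ℝ) * p 2) * p 1 := by nlinarith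
  have hn1 : (x:ℝ) * p 2 + (1 - (x:ℝ) * p 2) * p 1 ≤ 1 := by nlinarith
  have hE2 : (y:ℝ) * ((x:ℝ) * p 2 + (1 - (x:ℝ) * p 2) * p 1) ≤ y * 1 :=
    mul_le_mul_of_nonneg_left hn1 hy'.le
  exact ⟨by linarith, by linarith⟩

/-! ## The logarithmic term and its two primitives -/

/-- `W = ℓ₁ℓ₂ = [sx(1−y)/E₁]·[y(1−sx)/E₂]` on `□³`, with
`∂ₛW = xy(1−y)(1−sx)/(E₁²E₂) − s x² y(1−y)²/(E₁E₂²)`. [cite: KontsevichZagier2001, §1.1] -/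
theorem exists_fiveTerm_W {x y : ℚ} (hx : 0 < x) (hx1 : x < 1) (hy : 0 < y) (hy1 : y < 1) :
    ∃ T : RFun 3,
      (∀ p ∈ cube 3, T.fn p = (x:ℝ) * (1 - y) * p 2 * ((y:ℝ) * (1 - x * p 2)) /
        ((1 - (x:ℝ) * p 2 * ((y:ℝ) + (1 - y) * p 0)) *
          (1 - (y:ℝ) * ((x:ℝ) * p 2 + (1 - (x:ℝ) * p 2) * p 1)))) ∧
      (∀ p ∈ cube 3, (T.pd 2).fn p =
        (x:ℝ) * y * (1 - y) * (1 - x * p 2) /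
            ((1 - (x:ℝ) * p 2 * ((y:ℝ) + (1 - y) * p 0)) ^ 2 *
              (1 - (y:ℝ) * ((x:ℝ) * p 2 + (1 - (x:ℝ) * p 2) * p 1))) +
          -(p 2 * (x:ℝ) ^ 2 * y * (1 - y) ^ 2) /
            ((1 - (x:ℝ) * p 2 * ((y:ℝ) + (1 - y) * p 0)) *
              (1 - (y:ℝ) * ((x:ℝ) * p 2 + (1 - (x:ℝ) * p 2) * p 1)) ^ 2)) := by
  have hden : ∀ p ∈ cube 3, aeval p
      ((1 - C x * X 2 * (C y + C (1 - y) * X 0)) * (1 - C y * (C x * X 2 + (1 - C x * X 2) * X 1)) :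
        MvPolynomial (Fin 3) ℚ) ≠ 0 := by
    intro p hp
    have h := fiveTerm_log_den_pos hx hx1 hy hy1 hp
    simp only [map_sub, map_one, map_mul, map_add, aeval_C, aeval_X, eq_ratCast]
    exact mul_ne_zero h.1.ne' h.2.ne'
  refine ⟨⟨C (x * (1 - y)) * X 2 * (C y * (1 - C x * X 2)), _, hden⟩, fun p _ => ?_,
    fun p hp => ?_⟩
  · simp [RFun.fn_apply]
  · have h := fiveTerm_log_den_pos hx hx1 hy hy1 hp
    have h1 := h.1.ne'
    have h2 := h.2.ne'
    rw [rfun_pd_fn_eq]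
    simp only [map_sub, map_one, map_mul, map_add, pderiv_mul, pderiv_C, pderiv_one, pderiv_X,
      aeval_C, aeval_X, eq_ratCast]
    norm_num [Pi.single_apply, Fin.ext_iff]
    field_simp
    ring

/-- `G_W = (∂ₛ log E₁)·ℓ₂ = [−x(y + (1−y)p)/E₁]·[−y(1−sx)/E₂]` on `□³`, with
`∂ₚG_W = xy(1−y)(1−sx)/(E₁²E₂)`. [cite: KontsevichZagier2001, §1.1] -/
theorem exists_fiveTerm_GW {x y : ℚ} (hx : 0 < x) (hx1 : x < 1) (hy : 0 < y) (hy1 : y < 1) :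
    ∃ T : RFun 3,
      (∀ p ∈ cube 3, T.fn p = (x:ℝ) * y * ((y:ℝ) + (1 - y) * p 0) * (1 - x * p 2) /
        ((1 - (x:ℝ) * p 2 * ((y:ℝ) + (1 - y) * p 0)) *
          (1 - (y:ℝ) * ((x:ℝ) * p 2 + (1 - (x:ℝ) * p 2) * p 1)))) ∧
      (∀ p ∈ cube 3, (T.pd 0).fn p =
        (x:ℝ) * y * (1 - y) * (1 - x * p 2) /
          ((1 - (x:ℝ) * p 2 * ((y:ℝ) + (1 - y) * p 0)) ^ 2 *
            (1 - (y:ℝ) * ((x:ℝ) * p 2 + (1 - (x:ℝ) * p 2) * p 1)))) := by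
  have hden : ∀ p ∈ cube 3, aeval p
      ((1 - C x * X 2 * (C y + C (1 - y) * X 0)) * (1 - C y * (C x * X 2 + (1 - C x * X 2) * X 1)) :
        MvPolynomial (Fin 3) ℚ) ≠ 0 := by
    intro p hp
    have h := fiveTerm_log_den_pos hx hx1 hy hy1 hp
    simp only [map_sub, map_one, map_mul, map_add, aeval_C, aeval_X, eq_ratCast]
    exact mul_ne_zero h.1.ne' h.2.ne'
  refine ⟨⟨C (x * y) * (C y + C (1 - y) * X 0) * (1 - C x * X 2), _, hden⟩, fun p _ => ?_,
    fun p hp => ?_⟩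
  · simp [RFun.fn_apply]
  · have h := fiveTerm_log_den_pos hx hx1 hy hy1 hp
    have h1 := h.1.ne'
    have h2 := h.2.ne'
    rw [rfun_pd_fn_eq]
    simp only [map_sub, map_one, map_mul, map_add, pderiv_mul, pderiv_C, pderiv_one, pderiv_X,
      aeval_C, aeval_X, eq_ratCast]
    norm_num [Pi.single_apply, Fin.ext_iff]
    field_simp
    ring

/-- `H_W = ℓ₁·(∂ₛ log E₂) = [−sx(1−y)/E₁]·[−xy(1−q)/E₂]` on `□³`, with
`∂_qH_W = −s x² y(1−y)²/(E₁E₂²)`. [cite: KontsevichZagier2001, §1.1] -/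
theorem exists_fiveTerm_HW {x y : ℚ} (hx : 0 < x) (hx1 : x < 1) (hy : 0 < y) (hy1 : y < 1) :
    ∃ T : RFun 3,
      (∀ p ∈ cube 3, T.fn p = p 2 * (x:ℝ) ^ 2 * y * (1 - y) * (1 - p 1) /
        ((1 - (x:ℝ) * p 2 * ((y:ℝ) + (1 - y) * p 0)) *
          (1 - (y:ℝ) * ((x:ℝ) * p 2 + (1 - (x:ℝ) * p 2) * p 1)))) ∧
      (∀ p ∈ cube 3, (T.pd 1).fn p =
        -(p 2 * (x:ℝ) ^ 2 * y * (1 - y) ^ 2) /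
          ((1 - (x:ℝ) * p 2 * ((y:ℝ) + (1 - y) * p 0)) *
            (1 - (y:ℝ) * ((x:ℝ) * p 2 + (1 - (x:ℝ) * p 2) * p 1)) ^ 2)) := by
  have hden : ∀ p ∈ cube 3, aeval p
      ((1 - C x * X 2 * (C y + C (1 - y) * X 0)) * (1 - C y * (C x * X 2 + (1 - C x * X 2) * X 1)) :
        MvPolynomial (Fin 3) ℚ) ≠ 0 := by
    intro p hp
    have h := fiveTerm_log_den_pos hx hx1 hy hy1 hp
    simp only [map_sub, map_one, map_mul, map_add, aeval_C, aeval_X, eq_ratCast]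
    exact mul_ne_zero h.1.ne' h.2.ne'
  refine ⟨⟨X 2 * C (x ^ 2 * y * (1 - y)) * (1 - X 1), _, hden⟩, fun p _ => ?_, fun p hp => ?_⟩
  · simp [RFun.fn_apply]
    ring
  · have h := fiveTerm_log_den_pos hx hx1 hy hy1 hp
    have h1 := h.1.ne'
    have h2 := h.2.ne'
    rw [rfun_pd_fn_eq]
    simp only [map_sub, map_one, map_mul, map_add, map_pow, pderiv_mul, pderiv_C, pderiv_one,
      pderiv_X, aeval_C, aeval_X, eq_ratCast]
    norm_num [Pi.single_apply, Fin.ext_iff]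
    field_simp
    ring

/-! ## The three slabs of the residual dlog on `□²` -/

/-- The residual face functions on `□²` (coordinates `u = x₀`, `t = x₁`): the dlog slab
`F = x/(1 − txu)` and its two rescaled pieces `S₁ = y·F(yu, t) = xy/(1 − txyu)`,
`S₂ = (1−y)·F(y + (1−y)u, t) = x(1−y)/(1 − tx(y + (1−y)u))`, regular for `0 < x, y < 1`.
[cite: KontsevichZagier2001, §1.1] -/
theorem exists_fiveTerm_slabs {x y : ℚ} (hx : 0 < x) (hx1 : x < 1) (hy : 0 < y) (hy1 : y < 1) :
    ∃ F S₁ S₂ : RFun 2,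
      (∀ u ∈ cube 2, F.fn u = (x:ℝ) / (1 - u 1 * (x:ℝ) * u 0)) ∧
      (∀ u ∈ cube 2, S₁.fn u = (x:ℝ) * y / (1 - u 1 * (x:ℝ) * y * u 0)) ∧
      (∀ u ∈ cube 2, S₂.fn u = (x:ℝ) * (1 - y) / (1 - u 1 * (x:ℝ) * ((y:ℝ) + (1 - y) * u 0))) := by
  have hx' : (0:ℝ) < x := by exact_mod_cast hx
  have hx1' : (x:ℝ) < 1 := by exact_mod_cast hx1
  have hy' : (0:ℝ) < y := by exact_mod_cast hy
  have hy1' : (y:ℝ) < 1 := by exact_mod_cast hy1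
  have bnd : ∀ u ∈ cube 2, u 1 * (x:ℝ) * u 0 ≤ x ∧ u 1 * (x:ℝ) * y * u 0 ≤ x ∧
      u 1 * (x:ℝ) * ((y:ℝ) + (1 - y) * u 0) ≤ x := by
    intro u hu
    have h0 := hu 0; have h1 := hu 1
    have h10 : 0 ≤ u 1 * u 0 ∧ u 1 * u 0 ≤ 1 := ⟨mul_nonneg h1.1 h0.1, mul_le_one₀ h1.2 h0.1 h0.2⟩
    have hm0 : 0 ≤ (y:ℝ) + (1 - y) * u 0 := by nlinarith
    have hm1 : (y:ℝ) + (1 - y) * u 0 ≤ 1 := by nlinarith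
    have hxu : 0 ≤ u 1 * (x:ℝ) ∧ u 1 * (x:ℝ) ≤ x := ⟨by nlinarith, by nlinarith⟩
    refine ⟨by nlinarith, by nlinarith [mul_pos hx' hy'], ?_⟩
    calc u 1 * (x:ℝ) * ((y:ℝ) + (1 - y) * u 0) ≤ x * 1 := mul_le_mul hxu.2 hm1 hm0 hx'.le
      _ = x := mul_one _
  have hF : ∀ u ∈ cube 2, aeval u (1 - X 1 * C x * X 0 : MvPolynomial (Fin 2) ℚ) ≠ 0 := by
    intro u hu
    have h := (bnd u hu).1
    simp only [map_sub, map_one, map_mul, aeval_C, aeval_X, eq_ratCast]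
    intro h0; linarith
  have hS₁ : ∀ u ∈ cube 2, aeval u (1 - X 1 * C (x * y) * X 0 : MvPolynomial (Fin 2) ℚ) ≠ 0 := by
    intro u hu
    have h := (bnd u hu).2.1
    simp only [map_sub, map_one, map_mul, aeval_C, aeval_X, eq_ratCast]
    intro h0; linarith
  have hS₂ : ∀ u ∈ cube 2,
      aeval u (1 - X 1 * C x * (C y + C (1 - y) * X 0) : MvPolynomial (Fin 2) ℚ) ≠ 0 := by
    intro u hu
    have h := (bnd u hu).2.2
    simp only [map_sub, map_one, map_mul, map_add, aeval_C, aeval_X, eq_ratCast]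
    intro h0; linarith
  exact ⟨⟨C x, _, hF⟩, ⟨C (x * y), _, hS₁⟩, ⟨C (x * (1 - y)), _, hS₂⟩,
    fun u _ => by simp [RFun.fn_apply], fun u _ => by simp [RFun.fn_apply, mul_assoc],
    fun u _ => by simp [RFun.fn_apply]⟩

/-! ## The registered sub-goal stub -/

/-- **Stub `stub_fiveTermLogPrimitives`** (sub-goal of crux `ReductionRigidity`, stmt-3407, line
`Sketch`, growth deliverable G5, part 2): for rationals `0 < x, y < 1`, the logarithmic term
`W = ℓ₁ℓ₂` of the deformed five-term combination and its primitives `G_W`, `H_W` exist as regular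
rational functions on `□³` with the stated values and derivative values (exactness
`∂ₛW = ∂ₚG_W + ∂_qH_W` pointwise), and the three residual dlog slabs `F, S₁, S₂` exist on `□²`.
[cite: KontsevichZagier2001, §1.2 rule (3)] -/
theorem stub_fiveTermLogPrimitives :
    ∀ (x y : ℚ), 0 < x → x < 1 → 0 < y → y < 1 → ∃ (W GW HW : RFun 3) (F S₁ S₂ : RFun 2),
      (∀ p ∈ cube 3, W.fn p = (x:ℝ) * (1 - y) * p 2 * ((y:ℝ) * (1 - x * p 2)) /
        ((1 - (x:ℝ) * p 2 * ((y:ℝ) + (1 - y) * p 0)) *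
          (1 - (y:ℝ) * ((x:ℝ) * p 2 + (1 - (x:ℝ) * p 2) * p 1)))) ∧
      (∀ p ∈ cube 3, (W.pd 2).fn p =
        (x:ℝ) * y * (1 - y) * (1 - x * p 2) /
            ((1 - (x:ℝ) * p 2 * ((y:ℝ) + (1 - y) * p 0)) ^ 2 *
              (1 - (y:ℝ) * ((x:ℝ) * p 2 + (1 - (x:ℝ) * p 2) * p 1))) +
          -(p 2 * (x:ℝ) ^ 2 * y * (1 - y) ^ 2) /
            ((1 - (x:ℝ) * p 2 * ((y:ℝ) + (1 - y) * p 0)) *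
              (1 - (y:ℝ) * ((x:ℝ) * p 2 + (1 - (x:ℝ) * p 2) * p 1)) ^ 2)) ∧
      (∀ p ∈ cube 3, GW.fn p = (x:ℝ) * y * ((y:ℝ) + (1 - y) * p 0) * (1 - x * p 2) /
        ((1 - (x:ℝ) * p 2 * ((y:ℝ) + (1 - y) * p 0)) *
          (1 - (y:ℝ) * ((x:ℝ) * p 2 + (1 - (x:ℝ) * p 2) * p 1)))) ∧
      (∀ p ∈ cube 3, (GW.pd 0).fn p =
        (x:ℝ) * y * (1 - y) * (1 - x * p 2) /
          ((1 - (x:ℝ) * p 2 * ((y:ℝ) + (1 - y) * p 0)) ^ 2 *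
            (1 - (y:ℝ) * ((x:ℝ) * p 2 + (1 - (x:ℝ) * p 2) * p 1)))) ∧
      (∀ p ∈ cube 3, HW.fn p = p 2 * (x:ℝ) ^ 2 * y * (1 - y) * (1 - p 1) /
        ((1 - (x:ℝ) * p 2 * ((y:ℝ) + (1 - y) * p 0)) *
          (1 - (y:ℝ) * ((x:ℝ) * p 2 + (1 - (x:ℝ) * p 2) * p 1)))) ∧
      (∀ p ∈ cube 3, (HW.pd 1).fn p =
        -(p 2 * (x:ℝ) ^ 2 * y * (1 - y) ^ 2) /
          ((1 - (x:ℝ) * p 2 * ((y:ℝ) + (1 - y) * p 0)) *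
            (1 - (y:ℝ) * ((x:ℝ) * p 2 + (1 - (x:ℝ) * p 2) * p 1)) ^ 2)) ∧
      (∀ u ∈ cube 2, F.fn u = (x:ℝ) / (1 - u 1 * (x:ℝ) * u 0)) ∧
      (∀ u ∈ cube 2, S₁.fn u = (x:ℝ) * y / (1 - u 1 * (x:ℝ) * y * u 0)) ∧
      (∀ u ∈ cube 2, S₂.fn u = (x:ℝ) * (1 - y) / (1 - u 1 * (x:ℝ) * ((y:ℝ) + (1 - y) * u 0))) := by
  intro x y hx hx1 hy hy1
  obtain ⟨W, a₁, a₂⟩ := exists_fiveTerm_W hx hx1 hy hy1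
  obtain ⟨GW, a₃, a₄⟩ := exists_fiveTerm_GW hx hx1 hy hy1
  obtain ⟨HW, a₅, a₆⟩ := exists_fiveTerm_HW hx hx1 hy hy1
  obtain ⟨F, S₁, S₂, a₇, a₈, a₉⟩ := exists_fiveTerm_slabs hx hx1 hy hy1
  exact ⟨W, GW, HW, F, S₁, S₂, a₁, a₂, a₃, a₄, a₅, a₆, a₇, a₈, a₉⟩

end Summit.KontsevichZagierPeriods.HermiteRigidity.ReductionRigidity

end
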